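import Summits.BirchSwinnertonDyer.BirchSwinnertonDyer.Theses.PAdicOrderV2
import Summits.BirchSwinnertonDyer.BirchSwinnertonDyer.Theorems.PAdicOrderV2PAdicOrderComparisonR2StubParity
import Literature.NumberTheory.EllipticCurves.KatoRankBound
import Literature.NumberTheory.EllipticCurves.BSDSelmer
import Literature.NumberTheory.EllipticCurves.SelmerCorankHolds
import Literature.NumberTheory.EllipticCurves.ZpCorankQuasiIso

/-!
# BirchSwinnertonDyer / PAdicOrderV2 — crux `PAdicOrderPadicBSDrankR2` (stmt-0490), line `Sketch`:
# anatomy of the crux modulo Kato's bound (helper, `--supports`; does NOT close a stub)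

Write `S` for the crux: at every good ordinary prime `p` of every elliptic `E/ℚ` (globally minimal
`W`) and for the newform `f` of `E`, `ord_{T=0} L_p(E,T) = rank E(ℚ)`
(`L_p(E,T) = padicLFunction f (unitRoot W p)`). Two kernel-checked statements about WHAT `S` IS:

* `padicBSDrank_point_iff_of_kato` / `pAdicOrderPadicBSDrankR2_iff_of_kato` — **modulo Kato's
  printed inequality `corank_{ℤ_p} Sel_{p^∞}(E/ℚ) ≤ ord_{T=0} L_p(E,T)` (Astérisque 295, Thm 18.4,
  odd good ordinary `p`; the named tree fact `kato_selmerCorank_le_order_padicLFunction`, here a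
  HYPOTHESIS), the crux is EXACTLY the conjunction of three statements**: its own `p = 2` part;
  "no excess zeros" `ord_{T=0} L_p(E,T) ≤ corank_{ℤ_p} Sel_{p^∞}(E/ℚ)` at every odd good ordinary
  point; and `Ш[p^∞]`-cotorsion `corank_{ℤ_p} Ш(E/ℚ)[p^∞] = 0` at every odd good ordinary point of a
  modular `E`. (`⇐`: `rank ≤ corank ≤ ord ≤ corank = rank + 0`; `⇒`: `ord = rank ≤ corank`, and
  `corank ≤ ord = rank` forces `corank Ш[p^∞] = 0` by the PROVED corank identity
  `corank Sel_{p^∞} = rank + corank Ш[p^∞]`, `selmerCorank_eq_mordellWeilRank_add_holds`.) This is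
  the precise sense in which line `Sketch` splits the crux along `rank ≤ corank ≤ ord` with no loss:
  the no-excess leg is what the main conjecture ∧ `T`-semisimplicity (items stmt-15426, stmt-0509)
  deliver (`stub_padicBSDrank_orderEqCorankOdd`), the cotorsion leg is item stmt-0132 at the point.
* `padicBSDrank_of_order_le_one` — **the levels `ord_{T=0} L_p ≤ 1` of the crux at an odd good
  ordinary point are literature debt plus `Ш[p^∞]`-finiteness at the point, at ANY level `N` of
  the newform** (no Carayol): from Kato's bound and the Dokchitser–Dokchitser `p`-parity
  `corank ≡ r_an (mod 2)` at the point, and the LANDED level-free parity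
  `ord_T L_p ≡ r_an (mod 2)` (`stub_even_order_iff_even_analyticRank`, crux #2's line): `ord = 0`
  forces `corank = 0 = rank`; `ord = 1` forces `corank` odd and `≤ 1`, i.e. `corank = 1`, and then
  `rank = 1` once `Ш[p^∞]` is finite. So the open input of the crux beyond print and beyond `Ш`
  starts at `ord_{T=0} L_p ≥ 2` (Greenberg, LNM 1716, §1, Thm 1.5 and Conj. 1.12–1.13).
-/

-- D-0017: single-problem summit, so `Summit.BirchSwinnertonDyer.BirchSwinnertonDyer.…` repeats a
-- namespace BY DESIGN.
set_option linter.dupNamespace false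

namespace Summit.BirchSwinnertonDyer.BirchSwinnertonDyer.Theorems

open scoped MatrixGroups ModularForm
open CongruenceSubgroup Literature.NumberTheory.EllipticCurves
  Literature.NumberTheory.EllipticCurves.ModularForms
open Summit.BirchSwinnertonDyer.BirchSwinnertonDyer.Theses.PAdicOrderV2

/-- **The crux at one point, modulo Kato's inequality at that point.** For `E/ℚ` (globally minimal
`W`), a prime `p`, a cusp form `f`, with `L_p := padicLFunction f (unitRoot W p)`: if
`corank_{ℤ_p} Sel_{p^∞}(E/ℚ) ≤ ord_{T=0} L_p` (Kato, Thm 18.4, at the point), then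
`ord_{T=0} L_p = rank E(ℚ)` **iff** `ord_{T=0} L_p ≤ corank_{ℤ_p} Sel_{p^∞}(E/ℚ)` (no excess zeros)
**and** `corank_{ℤ_p} Ш(E/ℚ)[p^∞] = 0`. Uses only the proved corank identity
`corank Sel_{p^∞} = rank + corank Ш[p^∞]`. [cite: GreenbergLNM1716, §1 (p. 53) and Thm 1.5] -/
theorem padicBSDrank_point_iff_of_kato (W : WeierstrassCurve ℚ) [W.IsElliptic] [W.IsGloballyMinimal]
    (p : ℕ) [Fact p.Prime] {N : ℕ} (f : CuspForm (Gamma0 N) 2)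
    (hkato : (W.selmerCorank p : ℕ∞) ≤ (padicLFunction f (unitRoot W p : ℚ_[p])).order) :
    (padicLFunction f (unitRoot W p : ℚ_[p])).order = W.mordellWeilRank ↔
      (padicLFunction f (unitRoot W p : ℚ_[p])).order ≤ W.selmerCorank p ∧ W.shaCorank p = 0 := by
  have hid := W.selmerCorank_eq_mordellWeilRank_add_holds p
  constructor
  · intro h
    rw [h] at hkato ⊢
    have hle : W.selmerCorank p ≤ W.mordellWeilRank := by exact_mod_cast hkato
    exact ⟨by exact_mod_cast (show W.mordellWeilRank ≤ W.selmerCorank p by omega), by omega⟩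
  · rintro ⟨hNE, hsha⟩
    have heq : (padicLFunction f (unitRoot W p : ℚ_[p])).order = W.selmerCorank p :=
      le_antisymm hNE hkato
    rw [heq, hid, hsha, Nat.add_zero]

/-- **Anatomy of the crux modulo Kato's bound.** Granting the ∀-closure of the named fact
`kato_selmerCorank_le_order_padicLFunction` (Kato 2004, Thm 18.4: `corank Sel_{p^∞} ≤ ord_T L_p` at
every ODD good ordinary point), the crux `PAdicOrderPadicBSDrankR2` is EQUIVALENT to the conjunction
of: (RES2) its own `p = 2` part; (NE) no excess zeros `ord_{T=0} L_p(E,T) ≤ corank_{ℤ_p} Sel_{p^∞}(E/ℚ)`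
at every odd good ordinary point; (Ш) `corank_{ℤ_p} Ш(E/ℚ)[p^∞] = 0` at every odd good ordinary
point of a curve carrying a newform. (NE) is what the main conjecture ∧ `T`-semisimplicity supply
(items stmt-15426, stmt-0509; `stub_padicBSDrank_orderEqCorankOdd`), (Ш) is item stmt-0132 at the
point. [cite: GreenbergLNM1716, §1 Thm 1.5 and Conj. 1.12–1.13 (pp. 64–65)] -/
theorem pAdicOrderPadicBSDrankR2_iff_of_kato : (∀ (W : WeierstrassCurve ℚ) [W.IsElliptic]
    [W.IsGloballyMinimal] (p : ℕ) [Fact p.Prime] {N : ℕ} [NeZero N] (f : CuspForm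
    (CongruenceSubgroup.Gamma0 N) 2),
    Literature.NumberTheory.EllipticCurves.kato_selmerCorank_le_order_padicLFunction W p (f := f)) →
    (Summit.BirchSwinnertonDyer.BirchSwinnertonDyer.Theses.PAdicOrderV2.PAdicOrderPadicBSDrankR2 ↔
    ((∀ (W : WeierstrassCurve ℚ) [W.IsElliptic] [W.IsGloballyMinimal] (p : ℕ) [Fact p.Prime], p = 2 →
    Literature.NumberTheory.EllipticCurves.IsOrdinaryAt W p → ∀ {N : ℕ} [NeZero N] (f : CuspForm
    (CongruenceSubgroup.Gamma0 N) 2), Literature.NumberTheory.EllipticCurves.ModularForms.IsNewformOf W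
    f → (Literature.NumberTheory.EllipticCurves.padicLFunction f
    (Literature.NumberTheory.EllipticCurves.unitRoot W p : ℚ_[p])).order = W.mordellWeilRank) ∧ (∀ (W :
    WeierstrassCurve ℚ) [W.IsElliptic] [W.IsGloballyMinimal] (p : ℕ) [Fact p.Prime], p ≠ 2 →
    Literature.NumberTheory.EllipticCurves.IsOrdinaryAt W p → ∀ {N : ℕ} [NeZero N] (f : CuspForm
    (CongruenceSubgroup.Gamma0 N) 2), Literature.NumberTheory.EllipticCurves.ModularForms.IsNewformOf W
    f → (Literature.NumberTheory.EllipticCurves.padicLFunction f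
    (Literature.NumberTheory.EllipticCurves.unitRoot W p : ℚ_[p])).order ≤ W.selmerCorank p) ∧ (∀ (W :
    WeierstrassCurve ℚ) [W.IsElliptic] [W.IsGloballyMinimal] (p : ℕ) [Fact p.Prime], p ≠ 2 →
    Literature.NumberTheory.EllipticCurves.IsOrdinaryAt W p → ∀ {N : ℕ} [NeZero N] (f : CuspForm
    (CongruenceSubgroup.Gamma0 N) 2), Literature.NumberTheory.EllipticCurves.ModularForms.IsNewformOf W
    f → W.shaCorank p = 0))) := by
  intro hK
  constructor
  · intro hS
    refine ⟨fun W _ _ p _ _ hord N _ f hf ↦ hS W p hord f hf, fun W _ _ p _ hp hord N _ f hf ↦ ?_,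
      fun W _ _ p _ hp hord N _ f hf ↦ ?_⟩
    · exact ((padicBSDrank_point_iff_of_kato W p f (hK W p f hp hord hf)).mp (hS W p hord f hf)).1
    · exact ((padicBSDrank_point_iff_of_kato W p f (hK W p f hp hord hf)).mp (hS W p hord f hf)).2
  · rintro ⟨h2, hNE, hSha⟩ W _ _ p _ hord N _ f hf
    by_cases hp : p = 2
    · exact h2 W p hp hord f hf
    · exact (padicBSDrank_point_iff_of_kato W p f (hK W p f hp hord hf)).mpr
        ⟨hNE W p hp hord f hf, hSha W p hp hord f hf⟩

/-- **Levels `ord_{T=0} L_p ≤ 1` of the crux, at an odd good ordinary point and ANY level of the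
newform, from printed facts at the point plus finiteness of `Ш[p^∞]`.** Let `E/ℚ` (globally minimal
`W`) be good ordinary at the odd prime `p`, `f` a newform of `E` (any level `N`),
`L_p := padicLFunction f (unitRoot W p)`. Assume at the point: Kato's bound `corank Sel_{p^∞} ≤ ord_T L_p`
(Thm 18.4), the `p`-parity congruence `corank Sel_{p^∞} ≡ r_an (mod 2)` (Dokchitser–Dokchitser 2010
Thm 1.4), and `Ш(E/ℚ)[p^∞]` finite. If `ord_{T=0} L_p ≤ 1` then `ord_{T=0} L_p = rank E(ℚ)`:
`ord = 0 ⇒ corank = 0 = rank` (Kato, Kummer); `ord = 1 ⇒ r_an` odd by the level-free parity of the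
two functional equations (`stub_even_order_iff_even_analyticRank`, Greenberg LNM 1716 §5 p. 181)
`⇒ corank` odd and `≤ 1`, so `corank = 1 = rank + corank Ш[p^∞] = rank`. No Carayol (`N = N_E`) is
needed. [cite: GreenbergLNM1716, §1 Thm 1.5 and §5 (p. 181)] -/
theorem padicBSDrank_of_order_le_one (W : WeierstrassCurve ℚ) [W.IsElliptic] [W.IsGloballyMinimal]
    (p : ℕ) [Fact p.Prime] (hord : IsOrdinaryAt W p) {N : ℕ} [NeZero N]
    (f : CuspForm (Gamma0 N) 2) (hf : IsNewformOf W f)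
    (hkato : (W.selmerCorank p : ℕ∞) ≤ (padicLFunction f (unitRoot W p : ℚ_[p])).order)
    (hpar : W.selmerCorank p % 2 = W.analyticRank % 2)
    (hsha : Finite (AddCommGroup.primaryComponent W.sha p))
    (h1 : (padicLFunction f (unitRoot W p : ℚ_[p])).order ≤ 1) :
    (padicLFunction f (unitRoot W p : ℚ_[p])).order = W.mordellWeilRank := by
  have hid := W.selmerCorank_eq_mordellWeilRank_add_holds p
  have hsha0 : W.shaCorank p = 0 := by
    unfold WeierstrassCurve.shaCorank
    exact zpCorank_of_finite_eq_zero p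
  -- the order is `0` or `1`
  have hfin : (padicLFunction f (unitRoot W p : ℚ_[p])).order ≠ ⊤ := by
    intro htop
    rw [htop] at h1
    exact absurd h1 (by simp)
  obtain ⟨n, hn⟩ := ENat.ne_top_iff_exists.mp hfin
  rw [← hn] at hkato h1 ⊢
  have hn1 : n ≤ 1 := by exact_mod_cast h1
  have hcn : W.selmerCorank p ≤ n := by exact_mod_cast hkato
  rcases Nat.lt_or_ge n 1 with h0 | hge
  · -- `ord = 0`: `corank = 0 = rank`
    have hn0 : n = 0 := by omega
    subst hn0
    have hr : W.mordellWeilRank = 0 := by omega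
    rw [hr, Nat.cast_zero]
  · -- `ord = 1`: `r_an` odd (parity of the two functional equations), so `corank` odd, so `= 1`
    have hn1' : n = 1 := by omega
    subst hn1'
    have hpar' := stub_even_order_iff_even_analyticRank W p hord f hf
    rw [← hn] at hpar'
    have hodd : ¬ Even W.analyticRank := by
      intro hev
      have := hpar'.mpr hev
      simp at this
    have hra : W.analyticRank % 2 = 1 := Nat.odd_iff.mp (Nat.not_even_iff_odd.mp hodd)
    have hc1 : W.selmerCorank p = 1 := by omega
    have hr : W.mordellWeilRank = 1 := by omega
    rw [hr, Nat.cast_one]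

end Summit.BirchSwinnertonDyer.BirchSwinnertonDyer.Theorems
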